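import Mathlib
import HarnessLib
import HarnessLib.Audit
import Summits.HodgeConjecture.HodgeConjecture.Theses.KleimanBFSeeds
import Summits.HodgeConjecture.HodgeConjecture.Theorems.WeilTypeLadderLocalAnchor
import Literature.AlgebraicGeometry.HodgeTheory.WeilClassesSixfolds
import Literature.AlgebraicGeometry.HodgeTheory.WeilClassesLocalAnchor
import Literature.AlgebraicGeometry.HodgeTheory.WeilFamilyReach

/-!
# Skeleton `Lines/reach-secant-anchor` for crux `HyperbolicFloor` (stmt-HodgeConjecture-23604)

HONEST FRAMING: a crux PROOF SKELETON (cruxes-workfile class), not a proof. The crux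
`Theses.KleimanBFSeeds.HyperbolicFloor = Markman2025_weilClasses_algebraic_hyperbolicSixfold` (Markman, arXiv:2502.03415,
Thm. 1.5.1: the Weil classes of every HYPERBOLIC Weil-type abelian sixfold are algebraic — a claim under review, typed as an
open tree item: the route's FLOOR) is NOT proved here: the `sorry`s sit exactly inside the registered `stub_*`
declarations. Nothing here proves K-C⁺, H2, HC_AV or HC.

STRATEGY (line-writer seat `linewriter-hodgeav-h2sheaf` g0, 2026-08-31) — MARKMAN'S OWN PROOF SHAPE, through the LANDED ladder
engine `Summit.HodgeConjecture.HodgeConjecture.WeilTypeLadder.markman2025_hyperbolicSixfold_of_reach_of_localAnchor`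
(`Theorems/WeilTypeLadderLocalAnchor.lean`: the countable-union/Baire step, the reach along the family and the isogeny
transfer of Markman's last paragraph are kernel-checked there):

* `stub_reachHyperbolic` — Deligne's reach for hyperbolic members, BY NAME `weilFamilyReach_hyperbolic` (= the open item
  `ReachHyperbolic`, stmt-18883, whose own skeleton is `Cruxes/ReachHyperbolic/Lines/moduli_riemann.lean`: algebraic PEL
  moduli ⟂ Riemann realisability). [XL]
* `stub_secantAnchors` — MARKMAN'S NEW INPUT, Chern-character-free: for every `d ≥ 1` ONE hyperbolic Weil-type sixfold
  `(P, ψ₀, h_K)` with a non-zero rational Weil class whose transport is LOCALLY ALGEBRAIC along every admissible family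
  through `P` (`∀ d > 0, HasLocallyAlgebraicWeilAnchor 3 d` = the tree's named claim
  `Markman2025_secantAnchor_locallyAlgebraic_sixfold`: the secant sheaf of Thm. 1.4.1 is a semiregular twisted reflexive
  sheaf with `κ₃` in the Weil plane (Lemma 9.3.11), and the semiregularity theorem for twisted sheaves §7.4.2 spreads its
  class). [XL; FORESEEN SECOND LAYER, already typed in the tree: `stub_secantAnchors` ⟸ K-C (`ChernCharacterOnBetti`,
  stmt-19780) ∧ the twisted perfect door (`VHCAbelianSchemesRoad.TwistedPerfectDoor`, cf. stmt-20706) ∧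
  `∀ d > 0, OneHyperbolicWeilTwistedCarrier 3 d` (Markman's secant sheaf as ONE carrier per `d`) by
  `Ring2.AbelianAll.markman2025_hyperbolicSixfold_of_reach_of_twistedPerfectDoor_of_oneHyperbolicWeilTwistedCarrier` /
  `hasLocallyAlgebraicWeilAnchor_of_twistedPerfectDoorVHC_of_oneHyperbolicWeilCarrier` — i.e. the floor imported by name
  hides the route's OWN cruxes one dimension down plus one carrier per `d`.]
* `stub_rung_sqrtMinusThree` — RUNG (special case, first prover target): the crux at `d = 3` — hyperbolic `√-3`-sixfolds,
  decided in print WITHOUT Markman by Schoen's refereed cyclic-Prym construction ([Schoen1988Hodge] Thm. 2.0 + Cor. 3.1,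
  genus-4 degree-3 Pryms; Markman §1 p. 3 cites them as the trivial-discriminant case INSIDE Thm. 1.5.1; tree:
  `Schoen1988_cyclicPrym_weilClasses_algebraic_degreeThree_genusFour` + `Theorems/WeilTypeLadderNonsplitSixfoldsSqrtMinus3.lean`,
  conditional on a Prym-open anchored family) — outside the tree's proved regime. `rung_of_crux` (sorry-free) shows it IS
  the special case.

COMPOSITION `HyperbolicFloor_of := markman2025_hyperbolicSixfold_of_reach_of_localAnchor stub_reachHyperbolic stub_secantAnchors`.

References: [Markman2025SecantWeil] Thm. 1.4.1, Lemma 9.3.11, §7.4.2, Thm. 1.5.1, §1.5; [Deligne1982HodgeCycles] §4 proof of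
Thm. 4.8; [Schoen1988Hodge] Thm. 2.0, Cor. 3.1; [CharlesSchnell2014Notes] Prop. 11.3.11; [BuchweitzFlenner2003] Thm. 5.1.
-/

-- every declaration of this problem lives in `Summit.HodgeConjecture.HodgeConjecture.…` (summit = sub-problem)
set_option linter.dupNamespace false

noncomputable section

open CategoryTheory AlgebraicGeometry
open Literature.AlgebraicGeometry Literature.AlgebraicGeometry.Motives
open Literature.AlgebraicGeometry.HodgeTheory
open Literature.AlgebraicTopology.SingularHomology
open Summit.HodgeConjecture.HodgeConjecture.WeilTypeLadder

namespace Summit.HodgeConjecture.HodgeConjecture.Cruxes.HyperbolicFloor.ReachSecantAnchor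

/-- STUB (open, load-bearing, XL): Deligne's reach for hyperbolic Weil-type members, by name (= item `ReachHyperbolic`).
[cite: Deligne1982HodgeCycles, §4 Cor. 4.2 and proof of Thm. 4.8] -/
theorem stub_reachHyperbolic : weilFamilyReach_hyperbolic := by
  sorry

/-- STUB (open, load-bearing, XL): Markman's secant-sheaf anchors — one locally algebraic hyperbolic Weil anchor in
dimension 6 for every discriminant `d ≥ 1` (Chern-character-free local clause).
[cite: Markman2025SecantWeil, Thm. 1.4.1, Lemma 9.3.11 and §7.4.2] -/
theorem stub_secantAnchors : ∀ d : ℕ, 0 < d → HasLocallyAlgebraicWeilAnchor 3 d := by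
  sorry

/-- RUNG STUB (open, first prover target, L): the crux at `d = 3` — Weil classes on hyperbolic `√-3`-sixfolds (Schoen's
refereed cyclic Pryms + Baire + reach). [cite: Schoen1988Hodge, Thm. 2.0 and Cor. 3.1] [cite: Markman2025SecantWeil, §1 (p. 3)] -/
theorem stub_rung_sqrtMinusThree :
    ∀ (A : AbelianVariety ℂ) (φ : A ⟶ A), A.dim = 2 * 3 →
      IsSmoothProjective (2 * 3) A.X → φ ≫ φ = -((3 : ℕ) • 𝟙 A) →
        ∀ (e : ProjectiveEmbedding A.X) (a : complexBetti (projectiveSpace e.n ℂ) 2), IsRationalClass a → a ≠ 0 →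
          Motives.IsHyperbolicWeilType A φ 3
            ((((3 : ℕ) : ℂ)) • complexBetti.map e.ι 2 a +
              complexBetti.map φ.hom.hom.hom 2 (complexBetti.map e.ι 2 a)) →
            ∀ c : complexBetti A.X (2 * 3), IsRationalClass c →
              IsOfHodgeType (2 * 3) A.X (2 * 3) 3 3 c → c ∈ weilClassesOf A φ 3 3 →
                c ∈ algebraicClasses A.X 3 := by
  sorry

/-- Remark (sorry-free): the rung IS the crux at `d = 3`. -/
theorem rung_of_crux (h : Summit.HodgeConjecture.HodgeConjecture.Theses.KleimanBFSeeds.HyperbolicFloor) :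
    ∀ (A : AbelianVariety ℂ) (φ : A ⟶ A), A.dim = 2 * 3 →
      IsSmoothProjective (2 * 3) A.X → φ ≫ φ = -((3 : ℕ) • 𝟙 A) →
        ∀ (e : ProjectiveEmbedding A.X) (a : complexBetti (projectiveSpace e.n ℂ) 2), IsRationalClass a → a ≠ 0 →
          Motives.IsHyperbolicWeilType A φ 3
            ((((3 : ℕ) : ℂ)) • complexBetti.map e.ι 2 a +
              complexBetti.map φ.hom.hom.hom 2 (complexBetti.map e.ι 2 a)) →
            ∀ c : complexBetti A.X (2 * 3), IsRationalClass c →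
              IsOfHodgeType (2 * 3) A.X (2 * 3) 3 3 c → c ∈ weilClassesOf A φ 3 3 →
                c ∈ algebraicClasses A.X 3 :=
  h 3 (by norm_num)

/-- **Composition** (the ONLY theorem of this file concluding the crux): reach ∧ secant anchors give `HyperbolicFloor`
BY NAME through the landed ladder engine. -/
theorem HyperbolicFloor_of :
    Summit.HodgeConjecture.HodgeConjecture.Theses.KleimanBFSeeds.HyperbolicFloor :=
  markman2025_hyperbolicSixfold_of_reach_of_localAnchor stub_reachHyperbolic stub_secantAnchors

end Summit.HodgeConjecture.HodgeConjecture.Cruxes.HyperbolicFloor.ReachSecantAnchor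

end
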